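import Mathlib
import Summits.Ventures.PercRepro2.ZMeanProof
import Summits.Ventures.PercRepro2.PendantRoot
import Summits.Ventures.PercRepro2.PocketTransport
import Summits.Ventures.PercRepro2.PocketBHK
import Summits.Ventures.PercRepro2.PocketMasses
import Summits.Ventures.PercRepro2.HarrisRows
import Summits.Ventures.PercRepro2.StarGlue
import Summits.Ventures.PercRepro2.StarOAlgebra
import Summits.Ventures.PercRepro2.StarOEvents
import Summits.Ventures.PercRepro2.StarOProb
import Summits.Ventures.PercRepro2.StarOMassesA
import Summits.Ventures.PercRepro2.StarOMassesBC
import Summits.Ventures.PercRepro2.StarOXhatA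

/-!
# Event algebra under `Q` for the class-O table (blind cell PercRepro2, night-1 g8; NIGHT1-G8.md §4)

The mass identities of the three-coin star produce probabilities (under any weights `q`) of
events of the form `avoidAll ends a₂ {a₁} ∩ {o ↮ a_i} ∩ glue(x, y)`; here they are reduced to the ten-cell table
`Z₁, A_x, B_y, P_xy, c_ob` of NIGHT1-G8.md §1: under `avoidAll ends a₂ {a₁}` the events `{o ∈ C₁}`, `{o ∈ C₂}` are
disjoint, a `glue` union with a reflexive member is everything, and `{o ↔ b} ∖ U` is the cell `c_ob`.
-/

namespace Summit.Ventures.PercRepro2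

open StarGlue PendantRoot

namespace StarO

section EvAlg

variable {V : Type*} {E : Type*} [Fintype E] [DecidableEq E] [Fintype V] [DecidableEq V]
  {R : Type*} [Field R] [LinearOrder R] [IsStrictOrderedRing R]

variable (q : E → R) (ends : E → Sym2 V) (o a₁ a₂ b : V)

omit [Fintype E] [DecidableEq E] [Fintype V] [DecidableEq V] in
/-- Under `Q`, `o ∈ C₁` and `o ∈ C₂` are exclusive. -/
lemma Q_oL_oH_empty : avoidAll ends a₂ {a₁} ∩ connEvent ends a₁ o ∩ connEvent ends a₂ o = ∅ := by
  ext ω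
  simp only [Set.mem_inter_iff, mem_connEvent, Set.mem_empty_iff_false, iff_false, not_and,
    avoidAll_eq_compl, Set.mem_compl_iff]
  rintro ⟨hQ, h1⟩ h2
  exact hQ (conn_trans h1 (conn_symm h2))

omit [Fintype V] [DecidableEq V] [LinearOrder R] [IsStrictOrderedRing R] in
/-- `P(Q, o ∉ U) = Z₁ − A_L − A_H`. -/
lemma prob_Q_oN : prob q (avoidAll ends a₂ {a₁} ∩ (connEvent ends o a₁)ᶜ ∩ (connEvent ends o a₂)ᶜ) =
    prob q (avoidAll ends a₂ {a₁}) - prob q (avoidAll ends a₂ {a₁} ∩ connEvent ends a₁ o) - prob q (avoidAll ends a₂ {a₁} ∩ connEvent ends a₂ o) := by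
  have h1 := prob_inter_add_prob_inter_compl q (avoidAll ends a₂ {a₁}) (connEvent ends o a₁)
  have h2 := prob_inter_add_prob_inter_compl q (avoidAll ends a₂ {a₁} ∩ (connEvent ends o a₁)ᶜ) (connEvent ends o a₂)
  have e1 : avoidAll ends a₂ {a₁} ∩ (connEvent ends o a₁)ᶜ ∩ connEvent ends o a₂ = avoidAll ends a₂ {a₁} ∩ connEvent ends a₂ o := by
    ext ω
    simp only [Set.mem_inter_iff, avoidAll_eq_compl, Set.mem_compl_iff, mem_connEvent]
    constructor
    · rintro ⟨⟨hQ, _⟩, h⟩; exact ⟨hQ, conn_symm h⟩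
    · rintro ⟨hQ, h⟩
      exact ⟨⟨hQ, fun h' => hQ (conn_trans (conn_symm h') (conn_symm h))⟩, conn_symm h⟩
  rw [e1] at h2
  have e0 : avoidAll ends a₂ {a₁} ∩ connEvent ends o a₁ = avoidAll ends a₂ {a₁} ∩ connEvent ends a₁ o := by
    rw [connEvent_comm ends o a₁]
  rw [e0] at h1
  linear_combination h1 + h2

omit [Fintype V] [DecidableEq V] [LinearOrder R] [IsStrictOrderedRing R] in
/-- `P(Q, o ∉ U, o ∈ C₁) = 0` (and the `a₂` version). -/
lemma prob_Q_oN_oL_zero :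
    prob q (avoidAll ends a₂ {a₁} ∩ (connEvent ends o a₁)ᶜ ∩ (connEvent ends o a₂)ᶜ ∩ connEvent ends a₁ o) = 0 := by
  have : avoidAll ends a₂ {a₁} ∩ (connEvent ends o a₁)ᶜ ∩ (connEvent ends o a₂)ᶜ ∩ connEvent ends a₁ o = ∅ := by
    ext ω
    simp only [Set.mem_inter_iff, Set.mem_compl_iff, mem_connEvent, Set.mem_empty_iff_false,
      iff_false, not_and]
    rintro ⟨⟨_, h1⟩, _⟩ h
    exact h1 (conn_symm h)
  rw [this, prob_empty]

omit [Fintype V] [DecidableEq V] [LinearOrder R] [IsStrictOrderedRing R] in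
/-- `P(Q, o ∉ U, o ∈ C₂) = 0`. -/
lemma prob_Q_oN_oH_zero :
    prob q (avoidAll ends a₂ {a₁} ∩ (connEvent ends o a₁)ᶜ ∩ (connEvent ends o a₂)ᶜ ∩ connEvent ends a₂ o) = 0 := by
  have : avoidAll ends a₂ {a₁} ∩ (connEvent ends o a₁)ᶜ ∩ (connEvent ends o a₂)ᶜ ∩ connEvent ends a₂ o = ∅ := by
    ext ω
    simp only [Set.mem_inter_iff, Set.mem_compl_iff, mem_connEvent, Set.mem_empty_iff_false,
      iff_false, not_and]
    rintro ⟨⟨_, _⟩, h2⟩ h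
    exact h2 (conn_symm h)
  rw [this, prob_empty]

omit [Fintype E] [DecidableEq E] [Fintype V] [DecidableEq V] in
/-- A `glue23` with `x = a₂` is `{a₂ ↔ y} ∪ {o ↔ y}`. -/
lemma glue23_a2 (y : V) : glue23 ends a₂ o a₂ y = connEvent ends a₂ y ∪ connEvent ends o y := by
  ext ω
  simp only [glue23, Set.mem_union, Set.mem_inter_iff, mem_connEvent]
  constructor
  · rintro (h | ⟨_, h⟩ | ⟨_, h⟩)
    · exact Or.inl h
    · exact Or.inr h
    · exact Or.inl h
  · rintro (h | h)
    · exact Or.inl h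
    · exact Or.inr (Or.inl ⟨conn_refl _ _ _, h⟩)

omit [Fintype E] [DecidableEq E] [Fintype V] [DecidableEq V] in
/-- A `glue13` with `x = a₁` is `{a₁ ↔ y} ∪ {o ↔ y}`. -/
lemma glue13_a1 (y : V) : glue13 ends a₁ o a₁ y = connEvent ends a₁ y ∪ connEvent ends o y := by
  ext ω
  simp only [glue13, Set.mem_union, Set.mem_inter_iff, mem_connEvent]
  constructor
  · rintro (h | ⟨_, h⟩ | ⟨_, h⟩)
    · exact Or.inl h
    · exact Or.inr h
    · exact Or.inl h
  · rintro (h | h)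
    · exact Or.inl h
    · exact Or.inr (Or.inl ⟨conn_refl _ _ _, h⟩)

omit [Fintype E] [DecidableEq E] [Fintype V] [DecidableEq V] in
/-- Under `Q ∩ {o ↮ a₁}`, a `glue23` with `x = a₁` is `{a₁ ↔ y}`. -/
lemma Q_glue23_a1 (y : V) : avoidAll ends a₂ {a₁} ∩ (connEvent ends o a₁)ᶜ ∩ glue23 ends a₂ o a₁ y =
    avoidAll ends a₂ {a₁} ∩ (connEvent ends o a₁)ᶜ ∩ connEvent ends a₁ y := by
  ext ω
  simp only [glue23, Set.mem_inter_iff, Set.mem_union, mem_connEvent, avoidAll_eq_compl,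
    Set.mem_compl_iff]
  constructor
  · rintro ⟨⟨hQ, ho⟩, h | ⟨h, _⟩ | ⟨h, _⟩⟩
    · exact ⟨⟨hQ, ho⟩, h⟩
    · exact absurd h hQ
    · exact absurd (conn_symm h) ho
  · rintro ⟨⟨hQ, ho⟩, h⟩
    exact ⟨⟨hQ, ho⟩, Or.inl h⟩

omit [Fintype E] [DecidableEq E] [Fintype V] [DecidableEq V] in
/-- Under `Q ∩ {o ↮ a₂}`, a `glue13` with `x = a₂` is `{a₂ ↔ y}`. -/
lemma Q_glue13_a2 (y : V) : avoidAll ends a₂ {a₁} ∩ (connEvent ends a₂ o)ᶜ ∩ glue13 ends a₁ o a₂ y =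
    avoidAll ends a₂ {a₁} ∩ (connEvent ends a₂ o)ᶜ ∩ connEvent ends a₂ y := by
  ext ω
  simp only [glue13, Set.mem_inter_iff, Set.mem_union, mem_connEvent, avoidAll_eq_compl,
    Set.mem_compl_iff]
  constructor
  · rintro ⟨⟨hQ, ho⟩, h | ⟨h, _⟩ | ⟨h, _⟩⟩
    · exact ⟨⟨hQ, ho⟩, h⟩
    · exact absurd (conn_symm h) hQ
    · exact absurd h ho
  · rintro ⟨⟨hQ, ho⟩, h⟩
    exact ⟨⟨hQ, ho⟩, Or.inl h⟩

omit [Fintype V] [DecidableEq V] [LinearOrder R] [IsStrictOrderedRing R] in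
/-- `P(Q, o ↮ a₁, X) = P(Q, X) − P(Q, o ∈ C₁, X)`. -/
lemma prob_Q_not_oL (X : Set (Config E)) :
    prob q (avoidAll ends a₂ {a₁} ∩ (connEvent ends o a₁)ᶜ ∩ X) = prob q (avoidAll ends a₂ {a₁} ∩ X) - prob q (avoidAll ends a₂ {a₁} ∩ connEvent ends a₁ o ∩ X) := by
  have h := prob_inter_add_prob_inter_compl q (avoidAll ends a₂ {a₁} ∩ X) (connEvent ends o a₁)
  have e1 : avoidAll ends a₂ {a₁} ∩ X ∩ (connEvent ends o a₁)ᶜ = avoidAll ends a₂ {a₁} ∩ (connEvent ends o a₁)ᶜ ∩ X := by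
    rw [Set.inter_right_comm]
  have e2 : avoidAll ends a₂ {a₁} ∩ X ∩ connEvent ends o a₁ = avoidAll ends a₂ {a₁} ∩ connEvent ends a₁ o ∩ X := by
    rw [Set.inter_right_comm, connEvent_comm ends o a₁]
  rw [e1, e2] at h
  linear_combination h

omit [Fintype V] [DecidableEq V] [LinearOrder R] [IsStrictOrderedRing R] in
/-- `P(Q, o ↮ a₂, X) = P(Q, X) − P(Q, o ∈ C₂, X)`. -/
lemma prob_Q_not_oH (X : Set (Config E)) :
    prob q (avoidAll ends a₂ {a₁} ∩ (connEvent ends a₂ o)ᶜ ∩ X) = prob q (avoidAll ends a₂ {a₁} ∩ X) - prob q (avoidAll ends a₂ {a₁} ∩ connEvent ends a₂ o ∩ X) := by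
  have h := prob_inter_add_prob_inter_compl q (avoidAll ends a₂ {a₁} ∩ X) (connEvent ends a₂ o)
  have e1 : avoidAll ends a₂ {a₁} ∩ X ∩ (connEvent ends a₂ o)ᶜ = avoidAll ends a₂ {a₁} ∩ (connEvent ends a₂ o)ᶜ ∩ X := by
    rw [Set.inter_right_comm]
  have e2 : avoidAll ends a₂ {a₁} ∩ X ∩ connEvent ends a₂ o = avoidAll ends a₂ {a₁} ∩ connEvent ends a₂ o ∩ X := by
    rw [Set.inter_right_comm]
  rw [e1, e2] at h
  linear_combination h

/-- The cell `c_ob = P(Q, o ∉ U, b ∉ U, o ↔ b)`. -/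
noncomputable def cobMass : R :=
  prob q (avoidAll ends a₂ {a₁} ∩ (connEvent ends o a₁)ᶜ ∩ (connEvent ends o a₂)ᶜ ∩ (connEvent ends b a₁)ᶜ ∩
    (connEvent ends b a₂)ᶜ ∩ connEvent ends o b)

omit [LinearOrder R] [IsStrictOrderedRing R] in
/-- **The `b`-union under `o ↮ a₁`**: `P(Q, o ↮ a₁, b ∈ C₂ ∪ {o ↔ b}) = (B_H − P_LH) + c_ob`. -/
lemma prob_Q_not_oL_bH_union :
    prob q (avoidAll ends a₂ {a₁} ∩ (connEvent ends o a₁)ᶜ ∩ (connEvent ends a₂ b ∪ connEvent ends o b)) =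
      (prob q (avoidAll ends a₂ {a₁} ∩ connEvent ends a₂ b) - prob q (avoidAll ends a₂ {a₁} ∩ connEvent ends a₁ o ∩ connEvent ends a₂ b)) +
        cobMass q ends o a₁ a₂ b := by
  have hsplit : avoidAll ends a₂ {a₁} ∩ (connEvent ends o a₁)ᶜ ∩ (connEvent ends a₂ b ∪ connEvent ends o b) =
      (avoidAll ends a₂ {a₁} ∩ (connEvent ends o a₁)ᶜ ∩ connEvent ends a₂ b) ∪
        (avoidAll ends a₂ {a₁} ∩ (connEvent ends o a₁)ᶜ ∩ (connEvent ends o a₂)ᶜ ∩ (connEvent ends b a₁)ᶜ ∩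
          (connEvent ends b a₂)ᶜ ∩ connEvent ends o b) := by
    ext ω
    simp only [Set.mem_inter_iff, Set.mem_union, Set.mem_compl_iff, mem_connEvent,
      avoidAll_eq_compl]
    constructor
    · rintro ⟨⟨hQ, ho1⟩, h | h⟩
      · exact Or.inl ⟨⟨hQ, ho1⟩, h⟩
      · by_cases hb2 : Conn ends ω a₂ b
        · exact Or.inl ⟨⟨hQ, ho1⟩, hb2⟩
        · refine Or.inr ⟨⟨⟨⟨⟨hQ, ho1⟩, fun ho2 => hb2 (conn_trans (conn_symm ho2) h)⟩,
            fun hb1 => ho1 (conn_trans h hb1)⟩, fun hb2' => hb2 (conn_symm hb2')⟩, h⟩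
    · rintro (⟨⟨hQ, ho1⟩, h⟩ | ⟨⟨⟨⟨⟨hQ, ho1⟩, _⟩, _⟩, _⟩, h⟩)
      · exact ⟨⟨hQ, ho1⟩, Or.inl h⟩
      · exact ⟨⟨hQ, ho1⟩, Or.inr h⟩
  have hdisj : Disjoint (avoidAll ends a₂ {a₁} ∩ (connEvent ends o a₁)ᶜ ∩ connEvent ends a₂ b)
      (avoidAll ends a₂ {a₁} ∩ (connEvent ends o a₁)ᶜ ∩ (connEvent ends o a₂)ᶜ ∩ (connEvent ends b a₁)ᶜ ∩
        (connEvent ends b a₂)ᶜ ∩ connEvent ends o b) := by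
    rw [Set.disjoint_left]
    rintro ω ⟨_, h⟩ ⟨⟨⟨⟨_, _⟩, _⟩, hb2⟩, _⟩
    exact hb2 (conn_symm h)
  rw [hsplit, prob_union_of_disjoint q hdisj, prob_Q_not_oL]
  rfl

omit [LinearOrder R] [IsStrictOrderedRing R] in
/-- **The `b`-union under `o ↮ a₂`**: `P(Q, o ↮ a₂, b ∈ C₁ ∪ {o ↔ b}) = (B_L − P_HL) + c_ob`. -/
lemma prob_Q_not_oH_bL_union :
    prob q (avoidAll ends a₂ {a₁} ∩ (connEvent ends a₂ o)ᶜ ∩ (connEvent ends a₁ b ∪ connEvent ends o b)) =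
      (prob q (avoidAll ends a₂ {a₁} ∩ connEvent ends a₁ b) - prob q (avoidAll ends a₂ {a₁} ∩ connEvent ends a₂ o ∩ connEvent ends a₁ b)) +
        cobMass q ends o a₁ a₂ b := by
  have hsplit : avoidAll ends a₂ {a₁} ∩ (connEvent ends a₂ o)ᶜ ∩ (connEvent ends a₁ b ∪ connEvent ends o b) =
      (avoidAll ends a₂ {a₁} ∩ (connEvent ends a₂ o)ᶜ ∩ connEvent ends a₁ b) ∪
        (avoidAll ends a₂ {a₁} ∩ (connEvent ends o a₁)ᶜ ∩ (connEvent ends o a₂)ᶜ ∩ (connEvent ends b a₁)ᶜ ∩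
          (connEvent ends b a₂)ᶜ ∩ connEvent ends o b) := by
    ext ω
    simp only [Set.mem_inter_iff, Set.mem_union, Set.mem_compl_iff, mem_connEvent,
      avoidAll_eq_compl]
    constructor
    · rintro ⟨⟨hQ, ho2⟩, h | h⟩
      · exact Or.inl ⟨⟨hQ, ho2⟩, h⟩
      · by_cases hb1 : Conn ends ω a₁ b
        · exact Or.inl ⟨⟨hQ, ho2⟩, hb1⟩
        · refine Or.inr ⟨⟨⟨⟨⟨hQ, fun ho1 => hb1 (conn_trans (conn_symm ho1) h)⟩,
            fun ho2' => ho2 (conn_symm ho2')⟩, fun hb1' => hb1 (conn_symm hb1')⟩,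
            fun hb2 => ho2 (conn_trans (conn_symm hb2) (conn_symm h))⟩, h⟩
    · rintro (⟨⟨hQ, ho2⟩, h⟩ | ⟨⟨⟨⟨⟨hQ, _⟩, ho2⟩, _⟩, _⟩, h⟩)
      · exact ⟨⟨hQ, ho2⟩, Or.inl h⟩
      · exact ⟨⟨hQ, fun h' => ho2 (conn_symm h')⟩, Or.inr h⟩
  have hdisj : Disjoint (avoidAll ends a₂ {a₁} ∩ (connEvent ends a₂ o)ᶜ ∩ connEvent ends a₁ b)
      (avoidAll ends a₂ {a₁} ∩ (connEvent ends o a₁)ᶜ ∩ (connEvent ends o a₂)ᶜ ∩ (connEvent ends b a₁)ᶜ ∩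
        (connEvent ends b a₂)ᶜ ∩ connEvent ends o b) := by
    rw [Set.disjoint_left]
    rintro ω ⟨_, h⟩ ⟨⟨⟨_, hb1⟩, _⟩, _⟩
    exact hb1 (conn_symm h)
  rw [hsplit, prob_union_of_disjoint q hdisj, prob_Q_not_oH]
  rfl

end EvAlg


/-!
# Class O: the helper lemmas of the assembly (event algebra under `Q`, the isolated term) (blind cell PercRepro2,
night-1 g8; NIGHT1-G8.md §1, §4)

The masses of `HMFc` at the three-coin star are the expressions `zMass, dMass, …` of
`StarOAlgebra` in the table of the star-zeroed weights `pOut` (`HMFc_star_o`); the table satisfies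
the six slack inequalities (cross-cluster BHK `bhk_cross_gshare`, functional same-cluster BHK
`bhk_same_gshare`, the row-wise Harris `Eprod'_le`), so `classO_hmfc_nonneg` gives
`0 ≤ Z₁ · HMFc`; when `Z₁ = 0` every mass vanishes.  Hence **`HMF_star_o`** and `HCov_star_o`:
the first (HMF) class with an edge from `a₃` to a vertex outside `{a₁, a₂}` that is not in a root-only
pocket (the pocket boundary of NIGHT1-G7 §7′ crossed at `o`).
-/


section Main

open UnionCluster

variable {V : Type*} {E : Type*} [Fintype E] [DecidableEq E] [Fintype V] [DecidableEq V]
  {R : Type*} [Field R] [LinearOrder R] [IsStrictOrderedRing R]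

variable (p : E → R) (ends : E → Sym2 V) {f₁ f₂ f₃ : E} {a₃ a₁ a₂ o b : V}

omit [Fintype E] [DecidableEq E] [Fintype V] [DecidableEq V] in
/-- `Q` with the roots swapped. -/
lemma avoidAll_swap : avoidAll ends a₁ {a₂} = avoidAll ends a₂ {a₁} := by
  rw [avoidAll_eq_compl, avoidAll_eq_compl, connEvent_comm]

omit [Fintype E] [DecidableEq E] [Fintype V] [DecidableEq V] in
/-- `glue23` with `a₁` in the role of `a₂` is `glue13`. -/
lemma glue23_eq_glue13 (x y : V) : glue23 ends a₁ o x y = glue13 ends a₁ o x y := rfl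

omit [Fintype E] [DecidableEq E] [Fintype V] [DecidableEq V] in
/-- `{x ↔ x}` is everything. -/
lemma connEvent_self (x : V) : connEvent ends x x = Set.univ := by
  ext ω; simp [conn_refl]

omit [Fintype V] [DecidableEq V] [LinearOrder R] [IsStrictOrderedRing R] in
/-- The marginal `P(Q, X) = P(Q, oL, X) + P(Q, oH, X) + P(Q, oN, X)`. -/
lemma prob_Q_split_o (q : E → R) (X : Set (Config E)) :
    prob q (avoidAll ends a₂ {a₁} ∩ X) =
      prob q (avoidAll ends a₂ {a₁} ∩ connEvent ends a₁ o ∩ X) +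
        prob q (avoidAll ends a₂ {a₁} ∩ connEvent ends a₂ o ∩ X) +
        prob q (avoidAll ends a₂ {a₁} ∩ (connEvent ends o a₁)ᶜ ∩ (connEvent ends o a₂)ᶜ ∩ X) := by
  have h1 := prob_Q_not_oL q ends o a₁ a₂ X
  have h2 := prob_inter_add_prob_inter_compl q (avoidAll ends a₂ {a₁} ∩ (connEvent ends o a₁)ᶜ ∩ X)
    (connEvent ends o a₂)
  have e1 : avoidAll ends a₂ {a₁} ∩ (connEvent ends o a₁)ᶜ ∩ X ∩ connEvent ends o a₂ =
      avoidAll ends a₂ {a₁} ∩ connEvent ends a₂ o ∩ X := by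
    ext ω
    simp only [Set.mem_inter_iff, avoidAll_eq_compl, Set.mem_compl_iff, mem_connEvent]
    constructor
    · rintro ⟨⟨⟨hQ, _⟩, hX⟩, h⟩; exact ⟨⟨hQ, conn_symm h⟩, hX⟩
    · rintro ⟨⟨hQ, h⟩, hX⟩
      exact ⟨⟨⟨hQ, fun h' => hQ (conn_trans (conn_symm h') (conn_symm h))⟩, hX⟩, conn_symm h⟩
  have e2 : avoidAll ends a₂ {a₁} ∩ (connEvent ends o a₁)ᶜ ∩ X ∩ (connEvent ends o a₂)ᶜ =
      avoidAll ends a₂ {a₁} ∩ (connEvent ends o a₁)ᶜ ∩ (connEvent ends o a₂)ᶜ ∩ X := by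
    rw [Set.inter_right_comm]
  rw [e1, e2] at h2
  linear_combination -h1 - h2

omit [Fintype E] [DecidableEq E] [Fintype V] [DecidableEq V] in
/-- `X ∩ {x ↔ y} ∩ {x ↔ y}`. -/
lemma inter_conn_self (X : Set (Config E)) (x y : V) :
    X ∩ connEvent ends x y ∩ connEvent ends x y = X ∩ connEvent ends x y := by
  rw [Set.inter_assoc, Set.inter_self]

omit [Fintype E] [DecidableEq E] [Fintype V] [DecidableEq V] in
/-- Under `Q`, `o ∈ C₂` and `o ∈ C₁` are exclusive (the other order). -/
lemma Q_oH_oL_empty : avoidAll ends a₂ {a₁} ∩ connEvent ends a₂ o ∩ connEvent ends a₁ o = ∅ := by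
  rw [Set.inter_right_comm]; exact Q_oL_oH_empty ends o a₁ a₂

omit [Fintype V] [DecidableEq V] [LinearOrder R] [IsStrictOrderedRing R] in
/-- `P(Q, o ↮ a₁) = Z₁ − A_L`. -/
lemma prob_Q_not_oL_univ (q : E → R) :
    prob q (avoidAll ends a₂ {a₁} ∩ (connEvent ends o a₁)ᶜ) =
      prob q (avoidAll ends a₂ {a₁}) - prob q (avoidAll ends a₂ {a₁} ∩ connEvent ends a₁ o) := by
  have := prob_Q_not_oL q ends o a₁ a₂ Set.univ
  simpa only [Set.inter_univ] using this

omit [Fintype V] [DecidableEq V] [LinearOrder R] [IsStrictOrderedRing R] in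
/-- `P(Q, o ↮ a₂) = Z₁ − A_H`. -/
lemma prob_Q_not_oH_univ (q : E → R) :
    prob q (avoidAll ends a₂ {a₁} ∩ (connEvent ends a₂ o)ᶜ) =
      prob q (avoidAll ends a₂ {a₁}) - prob q (avoidAll ends a₂ {a₁} ∩ connEvent ends a₂ o) := by
  have := prob_Q_not_oH q ends o a₁ a₂ Set.univ
  simpa only [Set.inter_univ] using this

omit [Fintype E] [DecidableEq E] in
/-- `restrict` to everything is the identity. -/
lemma restrict_univ_compl_empty (ω : Config E) :
    restrict (touches ends (↑(∅ : Finset V) : Set V))ᶜ ω = ω := by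
  funext e
  apply restrict_apply_of_mem
  rintro ⟨x, hx, _⟩
  simp at hx

omit [LinearOrder R] [IsStrictOrderedRing R] in
/-- The isolated term: `Z₁ · termW{a₃} = A_L B_H + A_H B_L` (the cleared `X₀`). -/
lemma termW_singleton_eq (h31 : a₃ ≠ a₁) (h32 : a₃ ≠ a₂) (h3o : a₃ ≠ o) (h3b : a₃ ≠ b)
    (hZ : prob (pOut p ends a₃) (avoidAll ends a₂ {a₁}) ≠ 0) :
    prob (pOut p ends a₃) (avoidAll ends a₂ {a₁}) * termW p ends o a₁ a₂ b {a₃} =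
      prob (pOut p ends a₃) (avoidAll ends a₂ {a₁} ∩ connEvent ends a₁ o) *
          prob (pOut p ends a₃) (avoidAll ends a₂ {a₁} ∩ connEvent ends a₂ b) +
        prob (pOut p ends a₃) (avoidAll ends a₂ {a₁} ∩ connEvent ends a₂ o) *
          prob (pOut p ends a₃) (avoidAll ends a₂ {a₁} ∩ connEvent ends a₁ b) := by
  have e0 : ({a₃} : Finset V) = insert a₃ ∅ := by simp
  have tr : ∀ (β : Config E → Prop), prob p {ω | β (restrict (touches ends (↑({a₃} : Finset V) : Set V))ᶜ ω)} =
      prob (pOut p ends a₃) {ω | β ω} := by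
    intro β
    rw [e0, prob_resid_insert p ends ∅ β]
    congr 1
    ext ω
    simp only [Set.mem_setOf_eq, restrict_univ_compl_empty]
  have hQ : prob p (delQ ends {a₃} a₁ a₂) = prob (pOut p ends a₃) (avoidAll ends a₂ {a₁}) := by
    unfold delQ
    rw [prob_compl, avoidAll_eq_compl, prob_compl]
    congr 1
    exact tr (fun ω' => Conn ends ω' a₁ a₂)
  have hsh : ∀ x v, v ≠ a₃ → delShareMass p ends {a₃} a₁ a₂ x v =
      prob (pOut p ends a₃) (avoidAll ends a₂ {a₁} ∩ connEvent ends x v) := by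
    intro x v hv
    unfold delShareMass
    rw [if_neg (by simpa using hv.symm ∘ Eq.symm)]
    have := tr (fun ω' => ¬ Conn ends ω' a₁ a₂ ∧ Conn ends ω' x v)
    rw [avoidAll_eq_compl]
    exact this
  have h1 : a₁ ∉ ({a₃} : Finset V) := by simpa using h31.symm
  have h2 : a₂ ∉ ({a₃} : Finset V) := by simpa using h32.symm
  simp only [termW, h1, h2, ite_false, termPD, hsh a₁ o h3o.symm, hsh a₂ b h3b.symm, hsh a₂ o h3o.symm,
    hsh a₁ b h3b.symm, hQ]
  field_simp


end Main

end StarO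

end Summit.Ventures.PercRepro2
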